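/-
Copyright (c) 2026 the pub-hodgecm-mathlib formalisation cell (harness21).  Prover seat hodgecm-mathlib-LH4-p08 (g3), req620 Track A «(D-RAM) FOUR-FRAME» squad
(heir LEAD F0P3a-plan lineage; dealer LH4-plan (g11) WORD #26 (2); MS ROAD A, Stage B₂ brick B56₂-MULT INPUT, FILE G2-C2: the COUNT of the type-2 polarisation classes of the
ROOT-GLUED (`ρ = 0`) frame — `polarisationCount = q − 1`).  2026-09-04.
-/
import Summits.HodgeConjecture.HodgeConjecture.Theorems.F0P3cDyRamDiagonalGluedZeroPolarisationClassesTypeTwo  -- FILE G2-C1 (this seat): the family `D(α)`, (P1₀), `exists_stabiliser_iff_v_ratio_sub_le_zero`; brings ★ p856303, ★ p856296, ★ B1 FILE 2 `relIndex_fixedUnitLevel_eq`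
import Summits.HodgeConjecture.HodgeConjecture.Theorems.F0P3cDyRamDiagonalGluedPolarisationCountTypeTwo      -- FILE G2-B (this seat, p856515): `mem_coset_self`, `coset_eq_of_exists`; brings ★ StrataDefs ED. 3 `polarisationCosets`, `polarisationCount`
import Mathlib.GroupTheory.QuotientGroup.Basic
import HarnessLib

/-!
# Crux `H413`, MS ROAD A, STAGE B₂ brick B56₂-MULT, FILE G2-C2: «THE TYPE-2 MULTIPLICITY OF THE ROOT-GLUED STRATUM — `polarisationCount = q − 1`»

Cell `hodgecm-mathlib` (D-0151), FLOOR 0, crux item H413 = `stmt-HodgeConjecture-24833`; lane `--supports stmt-HodgeConjecture-24833 --as helper` (count-neutral).  THEOREMS ONLY.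
The re-keyed type-2 half of (MS) (LH4-p09 (g2) flag 2026-09-04T00:42:58Z; LH4-p10 (g2) 00:58:37Z; dealer WORD #21∕#26; LEAD (R-21)) weights each lattice by
`polarisationCount σ ϖ 2 M = #(Δ₂(M) ∕ S_F(M))` (★ StrataDefs ED. 3).  On the ROOT-GLUED stratum `G₁(1, s)` — `M = latt V`, `V = (1 0 0; 0 1 0; y″ ζ ϖ^{1+s})`, `|ζ| = 1`, `|y″| = |ϖ|^s`,
`s` even `≥ 2`, over a ramified quadratic datum with finite residue field — THIS FILE proves LH4-p09 (g2)'s table entry ∕ F0P3-p01 (g31)'s socket₂ binder `hmult` at `ρ = 0`: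
**`polarisationCount σ ϖ 2 (latt V) = q − 1`** (`polarisationCount_latt_glued_zero_typeTwo_eq`; LH4-r01 (g3) DV table: `1` at `q = 2`, `3` at `q = 4`).
PROOF.  By FILE G2-C1 the classes are the fibres of the invariant `r(D) = (D₀ + Ny″D₂)∕D₂` modulo `U_F(1) = {w : |w − 1| ≤ |ϖ|}` on the fixed sphere `|r| = |ϖ|^s`; the explicit
family `D(w)` (`w` a fixed unit) has `r(D(w)) = w·Ny″Nζ·P` (`P = π₀^{−s∕2}`), so `w ↦ D(w)·S_F(latt V)` induces a bijection `U_F ⧸ U_F(1) ≃ polarisationCosets σ ϖ 2 (latt V)`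
(`Quotient.liftOn'`; injective by G2-C1's criterion, surjective because every polarisation is `~ D(r(D)∕(Ny″NζP))`), and `[U_F : U_F(1)] = q − 1` is ★ B1 (C4)
`relIndex_fixedUnitLevel_eq` at level `1` (the subgroups `U_F`, `U_F(1)` of `Kˣ` built inline as in ★ `…CoreHangingClasses`).
HONEST LABEL.  Count-neutral; the census laws stay PROVER TARGETS until the MS assembly lands; `HC_CM` is proved only modulo the 7 printed citations (2 remaining named inputs:
hLiu418 = `stmt-HodgeConjecture-24832`, h413 = `stmt-HodgeConjecture-24833`) until rung 0 closes.

## References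
* [Kottwitz1986BaseChangeUnits] R. Kottwitz, *Base change for unit elements of Hecke algebras*, Compositio Math. 60 (1986), §1 pp. 240–241 (fixed-lattice counting, torus stabilisers).
* [Serre1979] J.-P. Serre, *Local Fields*, GTM 67 (1979), Ch. IV §2 Prop. 6 (the unit filtration `U⁽ⁿ⁾` and its quotients), Ch. I §6 Prop. 18.
-/

set_option autoImplicit false

noncomputable section

namespace Summit.HodgeConjecture.HodgeConjecture.Cruxes.H413.F0P3cDyRamDiagonalGluedZeroPolarisationCountTypeTwo

open Matrix
open Literature.NumberTheory.Automorphic Literature.NumberTheory.Automorphic.HermitianLattice Literature.NumberTheory.Automorphic.UnitaryGroup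
open Literature.NumberTheory.Automorphic.UnitaryLatticeTree
open Literature.NumberTheory.LocalFields.WildQuadraticDatum
open Summit.HodgeConjecture.HodgeConjecture.Cruxes.H413.F0P3cDyRamDiagonalTorusDefs
open Summit.HodgeConjecture.HodgeConjecture.Cruxes.H413.F0P3cDyRamDiagonalStrataDefs
open Summit.HodgeConjecture.HodgeConjecture.Cruxes.H413.F0P3cDyRamDiagonalGluedStabiliserIndex
open Summit.HodgeConjecture.HodgeConjecture.Cruxes.H413.F0P3cDyRamDiagonalGluedZeroPolarisationClassesTypeTwo
open Summit.HodgeConjecture.HodgeConjecture.Cruxes.H413.F0P3cDyRamDiagonalGluedPolarisationCountTypeTwo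
open scoped Valued WithZero Matrix MatrixGroups

variable {K : Type*} [Field K] [Valued K ℤᵐ⁰]

/-- **THE TYPE-2 MULTIPLICITY OF THE ROOT-GLUED STRATUM: `polarisationCount σ ϖ 2 (latt V) = q − 1`** (`V = (1 0 0; 0 1 0; y″ ζ ϖ^{1+s})`, `|ζ| = 1`, `|y″| = |ϖ|^s`, `s` even `≥ 2`,
ramified quadratic datum, finite residue field; no (R)-type hypothesis — every such lattice is polarisable, ★ p856303): the classes `D(w)·S_F(latt V)`, `w` over
`U_F ⧸ U_F(1) ≅ 𝓀^×` — LH4-p09 (g2)'s table «ρ = 0 → q − 1», F0P3-p01 (g31)'s «E = D₁ + NζD₂ free in U_F mod 𝔭_F». [cite: Kottwitz1986BaseChangeUnits, §1 pp. 240–241] [cite: Serre1979, Ch. IV §2 Prop. 6] -/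
theorem polarisationCount_latt_glued_zero_typeTwo_eq {σ : K →+* K} (hσ : ∀ a, σ (σ a) = a) (hvσ : ∀ a, Valued.v (σ a) = Valued.v a)
    (hfix : ∀ x : K, σ x = x → x ≠ 0 → ∃ n : ℤ, Valued.v x = WithZero.exp (2 * n)) {ϖ : K} (hϖ : Valued.v ϖ = WithZero.exp (-1 : ℤ))
    {d : ℕ} (hd : Valued.v (ϖ - σ ϖ) = Valued.v ϖ ^ d) [Finite 𝓀[K]]
    (s : ℕ) (hs2 : 2 ∣ s) (hs : 1 ≤ s) {ζ y'' : K} (hζ : Valued.v ζ = 1) (hy'' : Valued.v y'' = Valued.v ϖ ^ s)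
    (V : GL (Fin 3) K) (hV : (V : Matrix (Fin 3) (Fin 3) K) = !![1, 0, 0; 0, 1, 0; y'', ζ, ϖ ^ (1 + s)]) :
    polarisationCount σ ϖ 2 (latt (V : Matrix (Fin 3) (Fin 3) K)) = Nat.card 𝓀[K] - 1 := by
  obtain ⟨hϖ0, hϖ1⟩ := ne_zero_and_v_lt_one_of_v_eq_exp hϖ
  have hvϖ : 0 < Valued.v ϖ := (Valuation.pos_iff _).2 hϖ0
  set M := latt (V : Matrix (Fin 3) (Fin 3) K) with hM
  set Es : ℤᵐ⁰ := Valued.v ϖ ^ s with hEs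
  have hEs0 : Es ≠ 0 := pow_ne_zero _ hvϖ.ne'
  -- the fixed units `U` and the level-1 subgroup `U₁` of `Kˣ` (inline, as in ★ `…CoreHangingClasses`)
  let U : Subgroup Kˣ :=
    { carrier := {u | σ (u : K) = u ∧ Valued.v (u : K) = 1}
      mul_mem' := fun {a b} ha hb => ⟨by rw [Units.val_mul, map_mul, ha.1, hb.1], by rw [Units.val_mul, map_mul, ha.2, hb.2, mul_one]⟩
      one_mem' := ⟨by rw [Units.val_one, map_one], by rw [Units.val_one, map_one]⟩
      inv_mem' := fun {a} ha => ⟨by rw [Units.val_inv_eq_inv_val, map_inv₀, ha.1], by rw [Units.val_inv_eq_inv_val, map_inv₀, ha.2, inv_one]⟩ }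
  have hU : ∀ u : Kˣ, u ∈ U ↔ σ u = u ∧ Valued.v (u : K) = 1 := fun u => Iff.rfl
  let U₁ : Subgroup Kˣ :=
    { carrier := {u | (σ (u : K) = u ∧ Valued.v (u : K) = 1) ∧ Valued.v ((u : K) - 1) ≤ WithZero.exp (-((1 : ℕ) : ℤ))}
      mul_mem' := fun {a b} ha hb => by
        refine ⟨⟨by rw [Units.val_mul, map_mul, ha.1.1, hb.1.1], by rw [Units.val_mul, map_mul, ha.1.2, hb.1.2, mul_one]⟩, ?_⟩
        have h : (a : K) * b - 1 = a * ((b : K) - 1) + ((a : K) - 1) := by ring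
        rw [Units.val_mul, h]
        refine Valuation.map_add_le _ ?_ ha.2
        rw [map_mul, ha.1.2, one_mul]; exact hb.2
      one_mem' := ⟨⟨by rw [Units.val_one, map_one], by rw [Units.val_one, map_one]⟩, by rw [Units.val_one, sub_self, map_zero]; exact zero_le⟩
      inv_mem' := fun {a} ha => by
        refine ⟨⟨by rw [Units.val_inv_eq_inv_val, map_inv₀, ha.1.1], by rw [Units.val_inv_eq_inv_val, map_inv₀, ha.1.2, inv_one]⟩, ?_⟩
        have h : ((a⁻¹ : Kˣ) : K) - 1 = (a⁻¹ : Kˣ) * (1 - (a : K)) := by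
          rw [mul_sub, mul_one, ← Units.val_mul, inv_mul_cancel, Units.val_one]
        rw [h, map_mul, Units.val_inv_eq_inv_val, map_inv₀, ha.1.2, inv_one, one_mul, Valuation.map_sub_swap]
        exact ha.2 }
  have hU₁ : ∀ u : Kˣ, u ∈ U₁ ↔ (σ u = u ∧ Valued.v (u : K) = 1) ∧ Valued.v ((u : K) - 1) ≤ WithZero.exp (-((1 : ℕ) : ℤ)) := fun u => Iff.rfl
  have hidx : U₁.relIndex U = Nat.card 𝓀[K] - 1 := by
    rw [relIndex_fixedUnitLevel_eq hσ hvσ hfix hϖ hd hU le_rfl hU₁]; simp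
  have hexp1 : WithZero.exp (-((1 : ℕ) : ℤ)) = Valued.v ϖ := by rw [hϖ]; norm_num
  -- the scale `c₀ = Ny″·Nζ·P` of the invariant on the family
  set P : K := ((ϖ * σ ϖ) ^ (s / 2))⁻¹ with hP
  have hσϖ0 : σ ϖ ≠ 0 := fun h => hϖ0 (by rw [← hσ ϖ, h, map_zero])
  have hP0 : P ≠ 0 := inv_ne_zero (pow_ne_zero _ (mul_ne_zero hϖ0 hσϖ0))
  have hσP : σ P = P := by rw [hP, map_inv₀, map_pow, map_mul, hσ, mul_comm]
  have hvP : Valued.v P = Es⁻¹ := by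
    obtain ⟨t, rfl⟩ := hs2
    rw [hP, map_inv₀, map_pow, map_mul, hvσ, show 2 * t / 2 = t by omega, ← sq, ← pow_mul, hEs]
  set c₀ : K := σ y'' * y'' * (ζ * σ ζ) * P with hc₀
  have hσc₀ : σ c₀ = c₀ := by rw [hc₀]; simp only [map_mul, hσ, hσP]; ring
  have hvc₀ : Valued.v c₀ = Es := by
    rw [hc₀, map_mul, map_mul, map_mul, map_mul, hvσ, hvσ, hy'', hζ, hvP, mul_one, mul_one, mul_assoc, mul_inv_cancel₀ hEs0, mul_one]
  have hc₀0 : c₀ ≠ 0 := fun h => by rw [h, map_zero] at hvc₀; exact hEs0 hvc₀.symm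
  -- the family `D(w)` and its invariant `r(D(w)) = w·c₀`
  set Dsec : K → Fin 3 → K := fun w => ![σ y'' * y'' * P * (w * (ζ * σ ζ) * P - 1), w⁻¹ - P * (ζ * σ ζ), P] with hDsec
  have hsec : ∀ w : K, σ w = w → Valued.v w = 1 →
      (∀ i, σ (Dsec w i) = Dsec w i ∧ Dsec w i ≠ 0) ∧ IsVertexLattice σ ϖ (Matrix.diagonal (Dsec w)) 2 M :=
    fun w hσw hvw => isVertexLattice_two_latt_glued_zero_explicit hσ hvσ hϖ0 hϖ1 s hs2 hs hζ hy'' V hV hσw hvw hP rfl rfl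
  have hr : ∀ w : K, w ≠ 0 → (Dsec w 0 + σ y'' * Dsec w 2 * y'') / Dsec w 2 = w * c₀ := by
    intro w hw
    show (σ y'' * y'' * P * (w * (ζ * σ ζ) * P - 1) + σ y'' * P * y'') / P = w * (σ y'' * y'' * (ζ * σ ζ) * P)
    field_simp
    ring
  -- the class of a form
  set coset : (Fin 3 → K) → Set (Fin 3 → K) := fun D => {D' : Fin 3 → K | ∃ u ∈ fixedUnitStabilizer σ M, ∀ i, D' i = D i * ((u i : Kˣ) : K)} with hcoset
  -- relatedness on the family ⟺ `U₁`-congruence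
  have key : ∀ a b : U, (∃ u ∈ fixedUnitStabilizer σ M, ∀ i, Dsec (b : Kˣ) i = Dsec (a : Kˣ) i * ((u i : Kˣ) : K)) ↔ a⁻¹ * b ∈ U₁.subgroupOf U := by
    intro a b
    obtain ⟨hσa, hva⟩ := (hU a).1 a.2
    obtain ⟨hσb, hvb⟩ := (hU b).1 b.2
    have ha0 : ((a : Kˣ) : K) ≠ 0 := (a : Kˣ).ne_zero
    have hb0 : ((b : Kˣ) : K) ≠ 0 := (b : Kˣ).ne_zero
    obtain ⟨hDa, hva'⟩ := hsec _ hσa hva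
    obtain ⟨hDb, hvb'⟩ := hsec _ hσb hvb
    rw [exists_stabiliser_iff_v_ratio_sub_le_zero hvσ hfix hϖ s hs2 hs hζ hy'' V hV hDa hva' hDb hvb', hr _ ha0, hr _ hb0, Subgroup.mem_subgroupOf, hU₁,
      ← sub_mul, map_mul, hvc₀, pow_succ, hexp1]
    have hunit : σ (((a⁻¹ * b : U) : Kˣ) : K) = ((a⁻¹ * b : U) : Kˣ) ∧ Valued.v (((a⁻¹ * b : U) : Kˣ) : K) = 1 := (hU _).1 (a⁻¹ * b).2
    have e : Valued.v ((((a⁻¹ * b : U) : Kˣ) : K) - 1) = Valued.v (((a : Kˣ) : K) - (b : Kˣ)) := by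
      rw [Subgroup.coe_mul, Subgroup.coe_inv, Units.val_mul, Units.val_inv_eq_inv_val,
        show (((a : Kˣ) : K))⁻¹ * ((b : Kˣ) : K) - 1 = (((a : Kˣ) : K))⁻¹ * -(((a : Kˣ) : K) - (b : Kˣ)) by field_simp; ring,
        map_mul, Valuation.map_neg, map_inv₀, hva, inv_one, one_mul]
    rw [e]
    constructor
    · intro h
      refine ⟨hunit, le_of_mul_le_mul_right (h.trans_eq ?_) (zero_lt_iff.2 hEs0)⟩
      rw [hEs, mul_comm]
    · intro h
      calc Valued.v (((a : Kˣ) : K) - (b : Kˣ)) * Es ≤ Valued.v ϖ * Es := mul_le_mul' h.2 le_rfl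
        _ = Valued.v ϖ ^ s * Valued.v ϖ := by rw [hEs, mul_comm]
  -- the class map on `U ⧸ U₁`
  set g₀ : U → Set (Fin 3 → K) := fun a => coset (Dsec (a : Kˣ)) with hg₀
  have hg₀ : ∀ a b : U, (QuotientGroup.leftRel (U₁.subgroupOf U)) a b → g₀ a = g₀ b := by
    intro a b hab
    rw [QuotientGroup.leftRel_apply] at hab
    exact (coset_eq_of_exists σ M ((key a b).2 hab)).symm
  set g : U ⧸ U₁.subgroupOf U → Set (Fin 3 → K) := fun q => Quotient.liftOn' q g₀ hg₀ with hg
  have hgmk : ∀ a : U, g (a : U ⧸ U₁.subgroupOf U) = coset (Dsec (a : Kˣ)) := fun a => rfl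
  have hinj : Function.Injective g := by
    intro q₁ q₂ h
    induction q₁ using QuotientGroup.induction_on with
    | H a =>
      induction q₂ using QuotientGroup.induction_on with
      | H b =>
        rw [hgmk, hgmk] at h
        refine QuotientGroup.eq.2 ((key a b).1 ?_)
        have hmem : Dsec (b : Kˣ) ∈ coset (Dsec (a : Kˣ)) := by rw [h]; exact mem_coset_self σ M _
        exact hmem
  have hrange : Set.range g = polarisationCosets σ ϖ 2 M := by
    ext C
    constructor
    · rintro ⟨q, rfl⟩
      induction q using QuotientGroup.induction_on with
      | H a =>
        rw [hgmk]
        exact ⟨Dsec (a : Kˣ), hsec _ ((hU a).1 a.2).1 ((hU a).1 a.2).2, rfl⟩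
    · rintro ⟨D, ⟨hD, hvert⟩, rfl⟩
      obtain ⟨hvD2, ⟨ha, -, -⟩, -⟩ := structure_of_polarisation_zero hvσ hfix hϖ s hs2 hs hζ hy'' V hV hD hvert
      set r : K := (D 0 + σ y'' * D 2 * y'') / D 2 with hrdef
      have hσr : σ r = r := by rw [hrdef, map_div₀, map_add, map_mul, map_mul, hσ, (hD 0).1, (hD 2).1]; ring
      have hvr : Valued.v r = Es := by rw [hrdef, map_div₀, ha, hvD2, one_div, inv_inv]
      -- the fixed unit `w = r ∕ c₀`
      have hw0 : r / c₀ ≠ 0 := div_ne_zero (fun h => by rw [h, map_zero] at hvr; exact hEs0 hvr.symm) hc₀0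
      have hwU : Units.mk0 (r / c₀) hw0 ∈ U := by
        rw [hU, Units.val_mk0, map_div₀, hσr, hσc₀, map_div₀, hvr, hvc₀, div_self hEs0]; exact ⟨rfl, rfl⟩
      refine ⟨((⟨Units.mk0 (r / c₀) hw0, hwU⟩ : U) : U ⧸ U₁.subgroupOf U), ?_⟩
      rw [hgmk]
      obtain ⟨hDw, hvw⟩ := hsec (r / c₀) (by rw [map_div₀, hσr, hσc₀]) (by rw [map_div₀, hvr, hvc₀, div_self hEs0])
      refine coset_eq_of_exists σ M ((exists_stabiliser_iff_v_ratio_sub_le_zero hvσ hfix hϖ s hs2 hs hζ hy'' V hV hD hvert hDw hvw).2 ?_)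
      show Valued.v (r - (Dsec (r / c₀) 0 + σ y'' * Dsec (r / c₀) 2 * y'') / Dsec (r / c₀) 2) ≤ Valued.v ϖ ^ (s + 1)
      rw [hr _ hw0, div_mul_cancel₀ _ hc₀0, sub_self, map_zero]; exact zero_le
  rw [polarisationCount_eq, ← hrange, Set.ncard_range_of_injective hinj, ← Subgroup.index_eq_card, ← hidx]
  rfl

/-- **THE SAME IN `ℚ`** (the letter of F0P3-p01 (g31)'s socket₂ binder `hmult` at `ρ = 0`, modulo `Nat.card_eq_fintype_card`): `(polarisationCount σ ϖ 2 (latt V) : ℚ) = q − 1`.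
[cite: Kottwitz1986BaseChangeUnits, §1 pp. 240–241] -/
theorem polarisationCount_latt_glued_zero_typeTwo_cast_eq {σ : K →+* K} (hσ : ∀ a, σ (σ a) = a) (hvσ : ∀ a, Valued.v (σ a) = Valued.v a)
    (hfix : ∀ x : K, σ x = x → x ≠ 0 → ∃ n : ℤ, Valued.v x = WithZero.exp (2 * n)) {ϖ : K} (hϖ : Valued.v ϖ = WithZero.exp (-1 : ℤ))
    {d : ℕ} (hd : Valued.v (ϖ - σ ϖ) = Valued.v ϖ ^ d) [Finite 𝓀[K]]
    (s : ℕ) (hs2 : 2 ∣ s) (hs : 1 ≤ s) {ζ y'' : K} (hζ : Valued.v ζ = 1) (hy'' : Valued.v y'' = Valued.v ϖ ^ s)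
    (V : GL (Fin 3) K) (hV : (V : Matrix (Fin 3) (Fin 3) K) = !![1, 0, 0; 0, 1, 0; y'', ζ, ϖ ^ (1 + s)]) :
    (polarisationCount σ ϖ 2 (latt (V : Matrix (Fin 3) (Fin 3) K)) : ℚ) = (Nat.card 𝓀[K] : ℚ) - 1 := by
  rw [polarisationCount_latt_glued_zero_typeTwo_eq hσ hvσ hfix hϖ hd s hs2 hs hζ hy'' V hV, Nat.cast_sub (Nat.card_pos (α := 𝓀[K])), Nat.cast_one]

end Summit.HodgeConjecture.HodgeConjecture.Cruxes.H413.F0P3cDyRamDiagonalGluedZeroPolarisationCountTypeTwo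

end
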